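import Summits.KontsevichZagierPeriods.KontsevichZagierPeriods.Theses.WeightLine
import Literature.NumberTheory.Transcendental.SemialgebraicAlgebraicPoints
import Literature.NumberTheory.Transcendental.LindemannWeierstrassProofs

/-!
# `ExpNotSemialgebraic` (stmt-KontsevichZagierPeriods-7182, route WeightLine) — proof

The route item `ExpNotSemialgebraic` (support #9 of route WeightLine): for all reals `a < b`, the real
exponential `x ↦ exp (x 0)` is NOT a `ℚ`-semialgebraic function on the slab
`{x : Fin 1 → ℝ | x 0 ∈ (a, b)}`.

Proof (Hermite–Lindemann at one rational point). Pick a rational `t ∈ (a, b)` with `t ≠ 0`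
(`exists_rat_btwn`, twice if the first rational found is `0`). The value of a `ℚ`-semialgebraic
function of one real variable at an algebraic point of its domain is algebraic over `ℚ`
(`IsSemialgebraicFunOn.isAlgebraic_apply_one`, from Tarski–Seidenberg: the fibre of the graph over
`t` is a `ℚ`-semialgebraic singleton of `ℝ¹`, whose point is a boundary point, hence algebraic), so
`exp t` would be algebraic; but `exp t` is transcendental for algebraic `t ≠ 0` by the tree's
Hermite–Lindemann theorem `transcendental_exp_holds` (proved from Lindemann–Weierstrass).
-/

namespace Summit.KontsevichZagierPeriods.WeightLine

/-- Every non-empty open real interval contains a NON-ZERO rational number. [folklore] -/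
theorem exists_rat_mem_Ioo_ne_zero {a b : ℝ} (hab : a < b) :
    ∃ t : ℚ, (t : ℝ) ∈ Set.Ioo a b ∧ t ≠ 0 := by
  obtain ⟨q, hqa, hqb⟩ := exists_rat_btwn hab
  by_cases hq : q = 0
  · subst hq
    obtain ⟨r, hrq, hrb⟩ := exists_rat_btwn hqb
    refine ⟨r, ⟨hqa.trans hrq, hrb⟩, ?_⟩
    rintro rfl
    exact lt_irrefl _ hrq
  · exact ⟨q, ⟨hqa, hqb⟩, hq⟩

/-- **`ExpNotSemialgebraic`** (route WeightLine, stmt-KontsevichZagierPeriods-7182): for `a < b` the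
real exponential is not a `ℚ`-semialgebraic function on `{x : Fin 1 → ℝ | x 0 ∈ (a, b)}`. Proof: at a
non-zero rational `t ∈ (a, b)` a `ℚ`-semialgebraic function takes an algebraic value
(`IsSemialgebraicFunOn.isAlgebraic_apply_one`), while `exp t` is transcendental (Hermite–Lindemann,
`transcendental_exp_holds`). [cite: BakerTNT1975, Ch. 1 §3 Theorem 1.4, p. 6] -/
theorem expNotSemialgebraic_proof :
    Summit.KontsevichZagierPeriods.KontsevichZagierPeriods.Theses.WeightLine.ExpNotSemialgebraic := by
  intro a b hab hexp
  obtain ⟨t, ht, ht0⟩ := exists_rat_mem_Ioo_ne_zero hab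
  -- the value `exp t` of the `ℚ`-semialgebraic function at the rational point `t` is algebraic
  have halg : IsAlgebraic ℚ (Real.exp (t : ℝ)) :=
    Literature.NumberTheory.Transcendental.IsSemialgebraicFunOn.isAlgebraic_apply_one
      (S := Set.Ioo a b) (u := Real.exp) hexp ht (by simpa using isAlgebraic_algebraMap (A := ℝ) t)
  -- hence so is `cexp t = (exp t : ℂ)`
  have halgC : IsAlgebraic ℚ (Complex.exp (t : ℂ)) := by
    have h := halg.algebraMap (A := ℂ)
    simpa [Complex.ofReal_exp] using h
  -- contradicting Hermite–Lindemann
  have htC : IsAlgebraic ℚ ((t : ℚ) : ℂ) := by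
    simpa using isAlgebraic_algebraMap (R := ℚ) (A := ℂ) t
  have ht0C : ((t : ℚ) : ℂ) ≠ 0 := by exact_mod_cast ht0
  exact Literature.NumberTheory.Transcendental.transcendental_exp_holds htC ht0C halgC

end Summit.KontsevichZagierPeriods.WeightLine
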